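import Literature.MathematicalPhysics.QuantumFieldTheory.Balaban1983to89.B9Thm311DeltaPrimePos

/-!
# `Balaban1983to89.B9Thm311PosAtRecordV4` — row 17 of the N06 knit ([B9] Theorem 3.11) at def-Y's v4 letters of record with the clause `pos0`
# («Δ′_a(U) positive definite») DISCHARGED: FOUR displayed clauses; and the located residual — row 17 from the ONE clause «Δ_a(U) positive definite»
# (part 2 of 2, over `B9Thm311DeltaPrimePos`)

T. Bałaban, *Propagators for lattice gauge theories in a background field*, Commun. Math. Phys. **99** (1985) 389–434
[`Balaban1985BackgroundPropagators`, "B9"]; [4] = *Propagators … II*, Commun. Math. Phys. **96** (1984) 223–250 [`Balaban1984PropagatorsII`].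

statement-level skeleton of published theorems with citation tags; proofs where landed; nothing here is a claim about the
Yang–Mills mass gap

THE PRINTED LOCUS (verbatim, p. 416): *"Theorem 3.11. Under the assumptions of the Theorems 3.1–3.10 (i.e. for M sufficiently large and α₀ sufficiently
small) the operators Δ′_a, G′, (Q′G′²Q′\*)⁻¹, Δ_a, G are positive definite. This is obvious for the first three operators … hence it is enough to prove it
for G. It is a symmetric and invertible operator … Using the representation (3.105) we have G = G₀(I − R), hence …"*

WHY THIS FILE.  `B9Thm311SymmAtRecordV4` (gen 6) derived row 17 at def-Y's v4 instances `opsYOfRecordV4 ∕ opsYOfRecordV4E` from the pin `hPD` and FIVE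
displayed clauses `Inputs311Y₅` (pos0 unitA posG0 fac small), four of the nine printed-shape clauses being theorems there.  Part 1
(`B9Thm311DeltaPrimePos.deltaPrimeAY_parSymY_posDefTr`) makes `pos0` a theorem too — for EVERY `SU(N)`-valued background, in particular on (3.35).  THIS FILE
re-derives row 17 from FOUR displayed clauses (print's proof shape: Δ_a(U) invertible — Thm 3.3; Theorem 3.10's parametrix letters G₀, R with G₀ > 0,
G₀ = G(I − R), R small — (3.105)–(3.106), GAPS G-B9-06), and LOCATES the residual: with the free parametrix letters fixed to `G₀ := G(U)`, `R := 0` the four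
clauses follow from the ONE clause `PosDefTr 1 (Δ_a(U))` («Δ_a(U) is positive definite» — the fourth printed conclusion, equivalent to the fifth given the
symmetry `B9Thm311Curv2Symm.deltaAY_isSymmTr`), so row 17 at the record follows from the pin and exactly ONE analytic input: the positivity of the genuine
`Δ_a(U) = deltaAY _ parSymY parBY (GpY _ parSymY) U` on (3.35) — the content of Theorems 3.3∕3.10.

* §4 ★ `Inputs311Y₄` (unitA posG0 fac small), ★ `inputs311Y₅_of_four`, ★★ `t311_of_pins_opsYOfLettersV4₄`, ★★★ `t311_of_pins_opsYOfRecordV4₄ ∕ …V4E₄`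
  (row 17 at the v4 instances from the pin + FOUR clauses), `inputs311Y₄_lettersYOfRecordV4_one` (joint satisfiability at `U = 1`, A4 probe).
* §5 `proofLettersGA` (G₀ := G(U), R := 0; `= proofLettersOneV4` at the record, `rfl`), ★★ `inputs311Y₄_of_posDefTr_deltaAY` (four from one),
  `posDefTr_of_ringInverse`, ★ `posDefTr_deltaAY_parSymY_one` (the one clause HOLDS at `U = 1` — A4 probe),
  ★★★ `t311_of_pins_opsYOfLettersV4₁ ∕ …RecordV4₁ ∕ …RecordV4E₁` (row 17 over the v4 letters ∕ at the instances from the pin + ONE displayed clause).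
* §6 (v1.1) the THIRD operator: ★★ `XY_parSymY_posDefTr` (`(Q′G′²Q′\*)(U)` positive definite for the block-volume product at every `G`-valued `U` —
  [3] p.25's argument with its four inputs now theorems), `isUnit_XY_parSymY`, ★★ `XinvY_parSymY_posDefTr` (`(Q′G′²Q′\*)⁻¹(U) > 0`),
  ★★★ `thm311_firstThree_parSymY` («obvious for the first three operators» as ONE theorem at the v4 letters, every unitary background).

HONEST SCOPE.  Bookkeeping over part 1 and the gen-6 faces; the displayed clause(s) are printed-shape hypotheses about def-Y's GENUINE v4 operators — the
one-clause face displays a printed CONCLUSION of Theorem 3.11 as its input on purpose, to say exactly what is still owed at the record (Theorems 3.3∕3.10);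
nothing of [B9]'s analysis is asserted; NOT a node discharge, NOT summit progress; count-neutral; nothing continuum, nothing about the mass gap.
Cell `pub-ymgap` (HUMAN RULING D-0062), Track A node N06 [B9], seat `pub-ymgap-dag-n06-j` (harness re-seat gen 7), 2026-08-27.
-/

namespace Literature.MathematicalPhysics.QuantumFieldTheory.Balaban1983to89.B9Thm311PosAtRecordV4

open Literature.MathematicalPhysics.QuantumFieldTheory.Balaban1983to89
open B9Thm311Whole B9Thm311ReadingCoords B9Thm311ReadingAtLetters B9Thm311AdjointAtLetters B9Thm311DeltaPrimeSymm B9Thm311InputsAtOne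
  B9Thm311AdjointPairs B9Ineq349SiteAdjoint B9Thm311Curv2Symm B9Thm311SymmAtRecordV4 B9Thm311DeltaPrimePos Node00
open B6KLevelCensusIndexV1 B9PinMembersKLevelV1 B9PinGeometryKLevelV1 B7Prop2SpecialUnitary
open scoped Matrix

noncomputable section

/-! ## §4 Row 17 with FOUR displayed clauses -/

section Schema

open scoped Matrix.Norms.L2Operator

variable {d ℓ : ℕ} {hd : 1 ≤ d + 1} {hL : Odd (ℓ + 1) ∧ 1 < ℓ + 1} {b₀ b₁ : ℝ} {Mstar : ℕ} {N : ℕ}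

/-- ★ **THE FOUR REMAINING DISPLAYED INPUTS OF THEOREM 3.11 AT THE v4 LETTERS** (*"Under the assumptions of the Theorems 3.1–3.10"*): `unitA` — Δ_a(U)
invertible (Thm 3.3: G exists); `posG0`, `fac`, `small` — Theorem 3.10's parametrix letters G₀, R: G₀ positive, G₀ = G(I − R) ((3.105)–(3.106)),
⟨Ψ, RΨ⟩ ≦ θ₁M⁻¹⟨Ψ, Ψ⟩ (GAPS G-B9-06).  `pos0` (Δ′_a(U) > 0) is no longer displayed: it is `deltaPrimeAY_parSymY_posDefTr`.  Nothing asserted.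
[cite: Balaban1985BackgroundPropagators, Thm 3.11 proof p.416 + (3.105)–(3.106) p.414] -/
structure Inputs311Y₄ (x : MemberY d ℓ hd hL b₀ b₁ Mstar) (𝔏 : CovLettersY (Matrix (Fin N) (Fin N) ℂ) x) (𝔔 : ProofLetters311 N x.toKIdx)
    (θ₁ M : ℝ) (U : CfgY (Matrix (Fin N) (Fin N) ℂ) x.toKIdx) : Prop where
  unitA : IsUnit (deltaAY x.toKIdx 𝔏.parS 𝔏.parB 𝔏.Gp U)
  posG0 : PosDefTr (fun _ => (1 : ℝ)) (𝔔.G0 U)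
  fac : 𝔔.G0 U = 𝔏.GA U ∘ₗ (1 - 𝔔.R U)
  small : ∀ Ψ : FBondY x.toKIdx → Matrix (Fin N) (Fin N) ℂ,
    trIP (fun _ => (1 : ℝ)) Ψ (𝔔.R U Ψ) ≤ θ₁ * M⁻¹ * trIP (fun _ => (1 : ℝ)) Ψ Ψ

/-- ★ **FIVE FROM FOUR** at letters whose site transporter is pinned to `parSymY`, for a `G`-valued configuration, `G ≤ U(N)`: the clause `pos0` is
supplied by `deltaPrimeAY_parSymY_posDefTr`. [cite: Balaban1985BackgroundPropagators, Thm 3.11 p.416, (3.24) p.394, (3.35) p.396] -/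
theorem inputs311Y₅_of_four {G : Subgroup (Matrix (Fin N) (Fin N) ℂ)ˣ} (hG : G ≤ B7Prop2Explicit.unitaryUnits (Matrix (Fin N) (Fin N) ℂ))
    (x : MemberY d ℓ hd hL b₀ b₁ Mstar) (𝔏 : CovLettersY (Matrix (Fin N) (Fin N) ℂ) x) (𝔔 : ProofLetters311 N x.toKIdx)
    (hparS : 𝔏.parS = parSymY x.toKIdx) {θ₁ M : ℝ} {U : CfgY (Matrix (Fin N) (Fin N) ℂ) x.toKIdx} (hU : ∀ μ z, U μ z ∈ G)
    (h : Inputs311Y₄ x 𝔏 𝔔 θ₁ M U) : Inputs311Y₅ x 𝔏 𝔔 θ₁ M U where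
  pos0 := by rw [hparS]; exact deltaPrimeAY_parSymY_posDefTr x.toKIdx hG hU
  unitA := h.unitA
  posG0 := h.posG0
  fac := h.fac
  small := h.small

end Schema

section StageY

open scoped Matrix.Norms.L2Operator

variable {N : ℕ} (θ : Stage3Params) (Mstar : ℕ) (𝔯 : ResY N θ Mstar) (𝔈 : ExpsY N θ Mstar)

/-- ★★ **ROW 17 AT `opsYOfLetters` OVER THE v4 LETTERS** from the pin `hPD` and the FOUR-clause schema under (3.35) (`U` is `SU(N)`-valued there, so
`pos0` is a theorem). [cite: Balaban1985BackgroundPropagators, Thm 3.11 p.416 + (3.24) p.394 + (3.35) p.396] -/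
theorem t311_of_pins_opsYOfLettersV4₄ (𝔔 : ∀ x : MemberY θ.d₆ θ.ℓ₆ θ.hd' θ.hL' θ.b₀ θ.b₁ Mstar, ProofLetters311 N x.toKIdx)
    (θ₁ a₁ M₁ : ℝ) (ha₁ : 0 < a₁) (hM₁ : 0 < M₁)
    (h311 : ∀ x : MemberY θ.d₆ θ.ℓ₆ θ.hd' θ.hL' θ.b₀ θ.b₁ Mstar, M₁ ≤ (geo9Y x).M → ∀ α₀ : ℝ, 0 < α₀ → (geo9Y x).M * α₀ ≤ a₁ →
      ∀ U : (bg9Y (Matrix (Fin N) (Fin N) ℂ) (specialUnitaryUnits (Fin N)) x).Cfg,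
        (bg9Y (Matrix (Fin N) (Fin N) ℂ) (specialUnitaryUnits (Fin N)) x).Reg335 c35Y α₀ U →
          Inputs311Y₄ x (lettersYOfRecordV4 N θ Mstar 𝔯 x) (𝔔 x) θ₁ (geo9Y x).M U)
    (hPD : ∀ x : MemberY θ.d₆ θ.ℓ₆ θ.hd' θ.hL' θ.b₀ θ.b₁ Mstar,
      ((opsYOfLetters N θ Mstar (lettersYOfRecordV4 N θ Mstar 𝔯) 𝔈) x).PosDef = PosDefOfOps (ops311Y x (lettersYOfRecordV4 N θ Mstar 𝔯 x) (𝔔 x))) :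
    B9.Thm311Printed c35Y geo9Y (bg9Y (Matrix (Fin N) (Fin N) ℂ) (specialUnitaryUnits (Fin N)))
      (fun x => ((opsYOfLetters N θ Mstar (lettersYOfRecordV4 N θ Mstar 𝔯) 𝔈) x).PosDef) :=
  t311_of_pins_opsYOfLettersV4 θ Mstar 𝔯 𝔈 𝔔 θ₁ a₁ M₁ ha₁ hM₁
    (fun x hM α₀ hα₀ hMa U hU => inputs311Y₅_of_four specialUnitaryUnits_le_unitaryUnits x (lettersYOfRecordV4 N θ Mstar 𝔯 x) (𝔔 x) rfl
      hU.1.1 (h311 x hM α₀ hα₀ hMa U hU)) hPD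

/-- ★★★ **ROW 17 AT def-Y's v4 INSTANCE `opsYOfRecordV4 N θ M⋆ 𝔯 𝔈`** from the pin and FOUR displayed clauses — `pos0`, `symm0`, `adj`, `qps_inj`, `symmG`
and the two-sided inverse identities are THEOREMS about the genuine operators. [cite: Balaban1985BackgroundPropagators, Thm 3.11 p.416 + (3.24)–(3.27) pp.394–395 + (3.35) p.396] -/
theorem t311_of_pins_opsYOfRecordV4₄ (𝔔 : ∀ x : MemberY θ.d₆ θ.ℓ₆ θ.hd' θ.hL' θ.b₀ θ.b₁ Mstar, ProofLetters311 N x.toKIdx)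
    (θ₁ a₁ M₁ : ℝ) (ha₁ : 0 < a₁) (hM₁ : 0 < M₁)
    (h311 : ∀ x : MemberY θ.d₆ θ.ℓ₆ θ.hd' θ.hL' θ.b₀ θ.b₁ Mstar, M₁ ≤ (geo9Y x).M → ∀ α₀ : ℝ, 0 < α₀ → (geo9Y x).M * α₀ ≤ a₁ →
      ∀ U : (bg9Y (Matrix (Fin N) (Fin N) ℂ) (specialUnitaryUnits (Fin N)) x).Cfg,
        (bg9Y (Matrix (Fin N) (Fin N) ℂ) (specialUnitaryUnits (Fin N)) x).Reg335 c35Y α₀ U →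
          Inputs311Y₄ x (lettersYOfRecordV4 N θ Mstar 𝔯 x) (𝔔 x) θ₁ (geo9Y x).M U)
    (hPD : ∀ x : MemberY θ.d₆ θ.ℓ₆ θ.hd' θ.hL' θ.b₀ θ.b₁ Mstar,
      ((opsYOfRecordV4 N θ Mstar 𝔯 𝔈) x).PosDef = PosDefOfOps (ops311Y x (lettersYOfRecordV4 N θ Mstar 𝔯 x) (𝔔 x))) :
    B9.Thm311Printed c35Y geo9Y (bg9Y (Matrix (Fin N) (Fin N) ℂ) (specialUnitaryUnits (Fin N)))
      (fun x => ((opsYOfRecordV4 N θ Mstar 𝔯 𝔈) x).PosDef) :=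
  t311_of_pins_opsYOfLettersV4₄ θ Mstar 𝔯 𝔈 𝔔 θ₁ a₁ M₁ ha₁ hM₁ h311 hPD

/-- ★★★ **ROW 17 AT THE FULL v4 INSTANCE `opsYOfRecordV4E N θ M⋆ 𝔯 𝔢 𝔴 𝔈`** from the pin and FOUR displayed clauses (the knit's drop-in: `h311₅ ↦ h311₄`
without the `pos0` component). [cite: Balaban1985BackgroundPropagators, Thm 3.11 p.416 + (3.35) p.396] -/
theorem t311_of_pins_opsYOfRecordV4E₄ (𝔢 : SectEY N θ Mstar) (𝔴 : RWEY N θ Mstar)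
    (𝔔 : ∀ x : MemberY θ.d₆ θ.ℓ₆ θ.hd' θ.hL' θ.b₀ θ.b₁ Mstar, ProofLetters311 N x.toKIdx)
    (θ₁ a₁ M₁ : ℝ) (ha₁ : 0 < a₁) (hM₁ : 0 < M₁)
    (h311 : ∀ x : MemberY θ.d₆ θ.ℓ₆ θ.hd' θ.hL' θ.b₀ θ.b₁ Mstar, M₁ ≤ (geo9Y x).M → ∀ α₀ : ℝ, 0 < α₀ → (geo9Y x).M * α₀ ≤ a₁ →
      ∀ U : (bg9Y (Matrix (Fin N) (Fin N) ℂ) (specialUnitaryUnits (Fin N)) x).Cfg,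
        (bg9Y (Matrix (Fin N) (Fin N) ℂ) (specialUnitaryUnits (Fin N)) x).Reg335 c35Y α₀ U →
          Inputs311Y₄ x (lettersYOfRecordV4 N θ Mstar 𝔯 x) (𝔔 x) θ₁ (geo9Y x).M U)
    (hPD : ∀ x : MemberY θ.d₆ θ.ℓ₆ θ.hd' θ.hL' θ.b₀ θ.b₁ Mstar,
      ((opsYOfRecordV4E N θ Mstar 𝔯 𝔢 𝔴 𝔈) x).PosDef = PosDefOfOps (ops311Y x (lettersYOfRecordV4 N θ Mstar 𝔯 x) (𝔔 x))) :
    B9.Thm311Printed c35Y geo9Y (bg9Y (Matrix (Fin N) (Fin N) ℂ) (specialUnitaryUnits (Fin N)))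
      (fun x => ((opsYOfRecordV4E N θ Mstar 𝔯 𝔢 𝔴 𝔈) x).PosDef) :=
  t311_of_pins_opsYOfLettersV4₄ θ Mstar 𝔯 𝔈 𝔔 θ₁ a₁ M₁ ha₁ hM₁ h311 hPD

/-- the FOUR displayed clauses hold jointly at `U = 1` at the v4 letters (A4 probe; `θ₁ ≥ 0`, `M ≥ 0`) with `G₀ := G(1)`, `R := 0`.
[cite: Balaban1985BackgroundPropagators, Thm 3.11 p.416, p.395 (U = 1); Balaban1984PropagatorsII, p.228] -/
theorem inputs311Y₄_lettersYOfRecordV4_one (x : MemberY θ.d₆ θ.ℓ₆ θ.hd' θ.hL' θ.b₀ θ.b₁ Mstar) {θ₁ M : ℝ} (hθ₁ : 0 ≤ θ₁) (hM : 0 ≤ M) :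
    Inputs311Y₄ x (lettersYOfRecordV4 N θ Mstar 𝔯 x) (proofLettersOneV4 θ Mstar 𝔯 x) θ₁ M (fun _ _ => 1) :=
  have h := inputs311Y₅_lettersYOfRecordV4_one θ Mstar 𝔯 x hθ₁ hM
  ⟨h.unitA, h.posG0, h.fac, h.small⟩

end StageY

/-! ## §5 The located residual: row 17 from ONE displayed clause, the positivity of `Δ_a(U)` -/

section Residual

open scoped Matrix.Norms.L2Operator

variable {d ℓ : ℕ} {hd : 1 ≤ d + 1} {hL : Odd (ℓ + 1) ∧ 1 < ℓ + 1} {b₀ b₁ : ℝ} {Mstar : ℕ} {N : ℕ}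

/-- the parametrix letters CHOSEN TRIVIALLY: `G₀ := G(U)` (the family's own `GA`), `R := 0` — legitimate values of the free proof letters `𝔔` of the
row-17 schema (at the v4 record `= B9Thm311SymmAtRecordV4.proofLettersOneV4`, by `rfl`). [cite: Balaban1985BackgroundPropagators, (3.105)–(3.106) p.414, dictionary] -/
def proofLettersGA {x : MemberY d ℓ hd hL b₀ b₁ Mstar} (𝔏 : CovLettersY (Matrix (Fin N) (Fin N) ℂ) x) : ProofLetters311 N x.toKIdx where
  G0 := fun U => 𝔏.GA U
  R := fun _ => 0

/-- ★★ **THE FOUR CLAUSES FROM ONE**: at letters with `GA := GAY …` (`G(U) = Ring.inverse Δ_a(U)`, def-Y's (3.27)) and the trivial parametrix letters,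
`unitA`, `posG0`, `fac`, `small` (any `θ₁ ≥ 0`, `M ≥ 0`) all follow from the ONE clause `PosDefTr 1 (Δ_a(U))` — «Δ_a(U) is positive definite», itself
the FOURTH printed conclusion of Theorem 3.11 (and, given the symmetry `B9Thm311Curv2Symm.deltaAY_isSymmTr`, equivalent to the fifth, «G is positive
definite»): a positive definite operator on a finite lattice is a unit and its inverse is positive definite.  This LOCATES row 17's residual content at
the record: the positivity (= Theorems 3.3∕3.10's uniform invertibility) of `Δ_a(U)` on (3.35). [cite: Balaban1985BackgroundPropagators, Thm 3.11 p.416, (3.27) p.395] -/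
theorem inputs311Y₄_of_posDefTr_deltaAY (x : MemberY d ℓ hd hL b₀ b₁ Mstar) (𝔏 : CovLettersY (Matrix (Fin N) (Fin N) ℂ) x)
    (hGA : 𝔏.GA = GAY x.toKIdx 𝔏.parS 𝔏.parB 𝔏.Gp) {θ₁ M : ℝ} (hθ₁ : 0 ≤ θ₁) (hM : 0 ≤ M) {U : CfgY (Matrix (Fin N) (Fin N) ℂ) x.toKIdx}
    (hA : PosDefTr (fun _ => (1 : ℝ)) (deltaAY x.toKIdx 𝔏.parS 𝔏.parB 𝔏.Gp U)) :
    Inputs311Y₄ x 𝔏 (proofLettersGA 𝔏) θ₁ M U where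
  unitA := isUnit_of_posDefTr hA
  posG0 := by
    change PosDefTr (fun _ => (1 : ℝ)) (𝔏.GA U)
    rw [hGA]
    exact posDefTr_ringInverse hA
  fac := by
    change 𝔏.GA U = 𝔏.GA U ∘ₗ (1 - 0)
    rw [sub_zero, Module.End.one_eq_id, LinearMap.comp_id]
  small := by
    intro Ψ
    change trIP (fun _ => (1 : ℝ)) Ψ ((0 : (FBondY x.toKIdx → Matrix (Fin N) (Fin N) ℂ) →ₗ[ℂ] _) Ψ) ≤ _
    rw [LinearMap.zero_apply, trIP_zero_right]
    exact mul_nonneg (mul_nonneg hθ₁ (inv_nonneg.2 hM)) (trIP_self_nonneg _ (fun _ => one_pos) Ψ)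

/-- a unit whose `Ring.inverse` is positive definite is positive definite (`⟨Φ, TΦ⟩ = ⟨T⁻¹(TΦ), TΦ⟩ > 0`).
[cite: Balaban1985BackgroundPropagators, Thm 3.11 p.416 («Δ_a, G are positive definite»), bookkeeping] -/
theorem posDefTr_of_ringInverse {S : Type} [Fintype S] {w : S → ℝ} {T : (S → Matrix (Fin N) (Fin N) ℂ) →ₗ[ℂ] (S → Matrix (Fin N) (Fin N) ℂ)}
    (hT : IsUnit T) (h : PosDefTr w (Ring.inverse T)) : PosDefTr w T := by
  intro Φ hΦ
  have hΨ : T Φ ≠ 0 := fun h0 => hΦ (by rw [← inverse_apply_of_isUnit hT Φ, h0, map_zero])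
  have key := h (T Φ) hΨ
  rw [inverse_apply_of_isUnit hT, trIP_comm] at key
  exact key

/-- ★ **THE ONE DISPLAYED CLAUSE HOLDS AT `U = 1`** (A4 probe, any index): def-Y's genuine `Δ_a(1)` over the v4 transporters is positive definite — the
inverse of `G(1) = liftEndY (Gop)`, positive by NODE 00 ([4] p.228; `B9Thm311InputsAtOne.dotProduct_Gop_pos`).
[cite: Balaban1985BackgroundPropagators, Thm 3.11 p.416, p.395 (U = 1); Balaban1984PropagatorsII, p.228] -/
theorem posDefTr_deltaAY_parSymY_one (i : KIdx d ℓ hd hL b₀ b₁) :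
    PosDefTr (fun _ => (1 : ℝ))
      (deltaAY i (parSymY i) (parBY i) (GpY i (parSymY i)) (fun _ _ => 1 : CfgY (Matrix (Fin N) (Fin N) ℂ) i)) := by
  have hparS : ∀ z w, parSymY (𝔸 := Matrix (Fin N) (Fin N) ℂ) i (fun _ _ => 1) z w = 1 := fun z w => parSymY_one i z w
  have hparB : ∀ s s', parBY (𝔸 := Matrix (Fin N) (Fin N) ℂ) i (fun _ _ => 1) s s' = 1 := fun s s' => parBY_one i s s'
  have hGp : ∀ (f : SiteY i → ℝ) (E : Matrix (Fin N) (Fin N) ℂ),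
      GpY i (parSymY i) (fun _ _ => 1) (liftY f E) = liftY ((toKT i).G *ᵥ f) E := fun f E => GpY_one_liftY i (parSymY i) hparS f E
  have hpos : PosDefTr (fun _ => (1 : ℝ))
      (GAY i (parSymY i) (parBY i) (GpY i (parSymY i)) (fun _ _ => 1 : CfgY (Matrix (Fin N) (Fin N) ℂ) i)) := by
    rw [GAY_one i hparS hparB hGp]
    exact liftEndY_posDefTr _ (dotProduct_Gop_pos i)
  exact posDefTr_of_ringInverse (isUnit_deltaAY_one i hparS hparB hGp) hpos

variable (θ : Stage3Params) (Mstar : ℕ) (𝔯 : ResY N θ Mstar) (𝔈 : ExpsY N θ Mstar)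

/-- the trivial parametrix letters at the v4 record ARE `proofLettersOneV4`. [cite: Balaban1985BackgroundPropagators, (3.105)–(3.106) p.414, bookkeeping] -/
theorem proofLettersGA_lettersYOfRecordV4 (x : MemberY θ.d₆ θ.ℓ₆ θ.hd' θ.hL' θ.b₀ θ.b₁ Mstar) :
    proofLettersGA (lettersYOfRecordV4 N θ Mstar 𝔯 x) = proofLettersOneV4 θ Mstar 𝔯 x := rfl

/-- ★★★ **ROW 17 OVER THE v4 LETTERS FROM THE PIN AND ONE DISPLAYED CLAUSE** (generic expansion letters `𝔈` — the shape the knit consumes at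
ANY instance whose `PosDef` field is `𝔈`'s, e.g. `opsYNuOfRecordV4E`): the positivity of the genuine `Δ_a(U) = deltaAY _ parSymY parBY (GpY _ parSymY) U`
on (3.35) (print: a conclusion of Theorem 3.11 resting on Theorems 3.3∕3.10; GAPS G-B9-06), with the parametrix letters fixed to `G₀ := G(U)`, `R := 0` and
`θ₁ := 0`; every OTHER ingredient of Theorem 3.11 at the record (`pos0`, `symm0`, `adj`, `qps_inj`, `symmG`, the inverse identities, `G′ > 0`) is a theorem.
[cite: Balaban1985BackgroundPropagators, Thm 3.11 p.416 + (3.24)–(3.27) pp.394–395 + (3.35) p.396] -/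
theorem t311_of_pins_opsYOfLettersV4₁ (a₁ M₁ : ℝ) (ha₁ : 0 < a₁) (hM₁ : 0 < M₁)
    (hΔA : ∀ x : MemberY θ.d₆ θ.ℓ₆ θ.hd' θ.hL' θ.b₀ θ.b₁ Mstar, M₁ ≤ (geo9Y x).M → ∀ α₀ : ℝ, 0 < α₀ → (geo9Y x).M * α₀ ≤ a₁ →
      ∀ U : (bg9Y (Matrix (Fin N) (Fin N) ℂ) (specialUnitaryUnits (Fin N)) x).Cfg,
        (bg9Y (Matrix (Fin N) (Fin N) ℂ) (specialUnitaryUnits (Fin N)) x).Reg335 c35Y α₀ U →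
          PosDefTr (fun _ => (1 : ℝ))
            (deltaAY x.toKIdx (parSymY x.toKIdx) (parBY x.toKIdx) (GpY x.toKIdx (parSymY x.toKIdx)) U))
    (hPD : ∀ x : MemberY θ.d₆ θ.ℓ₆ θ.hd' θ.hL' θ.b₀ θ.b₁ Mstar,
      ((opsYOfLetters N θ Mstar (lettersYOfRecordV4 N θ Mstar 𝔯) 𝔈) x).PosDef
        = PosDefOfOps (ops311Y x (lettersYOfRecordV4 N θ Mstar 𝔯 x) (proofLettersOneV4 θ Mstar 𝔯 x))) :
    B9.Thm311Printed c35Y geo9Y (bg9Y (Matrix (Fin N) (Fin N) ℂ) (specialUnitaryUnits (Fin N)))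
      (fun x => ((opsYOfLetters N θ Mstar (lettersYOfRecordV4 N θ Mstar 𝔯) 𝔈) x).PosDef) :=
  t311_of_pins_opsYOfLettersV4₄ θ Mstar 𝔯 𝔈 (proofLettersOneV4 θ Mstar 𝔯) 0 a₁ M₁ ha₁ hM₁
    (fun x hM α₀ hα₀ hMa U hU => inputs311Y₄_of_posDefTr_deltaAY x (lettersYOfRecordV4 N θ Mstar 𝔯 x) rfl le_rfl (hM₁.le.trans hM)
      (hΔA x hM α₀ hα₀ hMa U hU)) hPD

/-- ★★★ **ROW 17 AT def-Y's v4 INSTANCE `opsYOfRecordV4 N θ M⋆ 𝔯 𝔈` FROM THE PIN AND ONE DISPLAYED CLAUSE.**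
[cite: Balaban1985BackgroundPropagators, Thm 3.11 p.416 + (3.35) p.396] -/
theorem t311_of_pins_opsYOfRecordV4₁ (a₁ M₁ : ℝ) (ha₁ : 0 < a₁) (hM₁ : 0 < M₁)
    (hΔA : ∀ x : MemberY θ.d₆ θ.ℓ₆ θ.hd' θ.hL' θ.b₀ θ.b₁ Mstar, M₁ ≤ (geo9Y x).M → ∀ α₀ : ℝ, 0 < α₀ → (geo9Y x).M * α₀ ≤ a₁ →
      ∀ U : (bg9Y (Matrix (Fin N) (Fin N) ℂ) (specialUnitaryUnits (Fin N)) x).Cfg,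
        (bg9Y (Matrix (Fin N) (Fin N) ℂ) (specialUnitaryUnits (Fin N)) x).Reg335 c35Y α₀ U →
          PosDefTr (fun _ => (1 : ℝ))
            (deltaAY x.toKIdx (parSymY x.toKIdx) (parBY x.toKIdx) (GpY x.toKIdx (parSymY x.toKIdx)) U))
    (hPD : ∀ x : MemberY θ.d₆ θ.ℓ₆ θ.hd' θ.hL' θ.b₀ θ.b₁ Mstar,
      ((opsYOfRecordV4 N θ Mstar 𝔯 𝔈) x).PosDef
        = PosDefOfOps (ops311Y x (lettersYOfRecordV4 N θ Mstar 𝔯 x) (proofLettersOneV4 θ Mstar 𝔯 x))) :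
    B9.Thm311Printed c35Y geo9Y (bg9Y (Matrix (Fin N) (Fin N) ℂ) (specialUnitaryUnits (Fin N)))
      (fun x => ((opsYOfRecordV4 N θ Mstar 𝔯 𝔈) x).PosDef) :=
  t311_of_pins_opsYOfLettersV4₁ θ Mstar 𝔯 𝔈 a₁ M₁ ha₁ hM₁ hΔA hPD

/-- ★★★ the same at the FULL v4 instance `opsYOfRecordV4E N θ M⋆ 𝔯 𝔢 𝔴 𝔈`. [cite: Balaban1985BackgroundPropagators, Thm 3.11 p.416 + (3.35) p.396] -/
theorem t311_of_pins_opsYOfRecordV4E₁ (𝔢 : SectEY N θ Mstar) (𝔴 : RWEY N θ Mstar) (a₁ M₁ : ℝ) (ha₁ : 0 < a₁) (hM₁ : 0 < M₁)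
    (hΔA : ∀ x : MemberY θ.d₆ θ.ℓ₆ θ.hd' θ.hL' θ.b₀ θ.b₁ Mstar, M₁ ≤ (geo9Y x).M → ∀ α₀ : ℝ, 0 < α₀ → (geo9Y x).M * α₀ ≤ a₁ →
      ∀ U : (bg9Y (Matrix (Fin N) (Fin N) ℂ) (specialUnitaryUnits (Fin N)) x).Cfg,
        (bg9Y (Matrix (Fin N) (Fin N) ℂ) (specialUnitaryUnits (Fin N)) x).Reg335 c35Y α₀ U →
          PosDefTr (fun _ => (1 : ℝ))
            (deltaAY x.toKIdx (parSymY x.toKIdx) (parBY x.toKIdx) (GpY x.toKIdx (parSymY x.toKIdx)) U))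
    (hPD : ∀ x : MemberY θ.d₆ θ.ℓ₆ θ.hd' θ.hL' θ.b₀ θ.b₁ Mstar,
      ((opsYOfRecordV4E N θ Mstar 𝔯 𝔢 𝔴 𝔈) x).PosDef
        = PosDefOfOps (ops311Y x (lettersYOfRecordV4 N θ Mstar 𝔯 x) (proofLettersOneV4 θ Mstar 𝔯 x))) :
    B9.Thm311Printed c35Y geo9Y (bg9Y (Matrix (Fin N) (Fin N) ℂ) (specialUnitaryUnits (Fin N)))
      (fun x => ((opsYOfRecordV4E N θ Mstar 𝔯 𝔢 𝔴 𝔈) x).PosDef) :=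
  t311_of_pins_opsYOfLettersV4₁ θ Mstar 𝔯 𝔈 a₁ M₁ ha₁ hM₁ hΔA hPD

end Residual

/-! ## §6 (v1.1) Theorem 3.11's THIRD operator: `(Q′G′²Q′*)(U)` and `C(U) = (Q′G′²Q′*)⁻¹(U)` are positive definite at every unitary background -/

section FirstThree

open scoped Matrix.Norms.L2Operator

variable {d ℓ : ℕ} {hd : 1 ≤ d + 1} {hL : Odd (ℓ + 1) ∧ 1 < ℓ + 1} {b₀ b₁ : ℝ} {N : ℕ}
variable (i : KIdx d ℓ hd hL b₀ b₁) {G : Subgroup (Matrix (Fin N) (Fin N) ℂ)ˣ}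

/-- ★★ **`(Q′G′²Q′\*)(U)` IS POSITIVE DEFINITE for the block-volume scalar product at EVERY `G`-valued configuration**, `G ≤ U(N)` ([3] p. 25: `G′`
symmetric positive and `Q′\*` injective) — `B9Thm311ReadingAtLetters.isUnit_XY_of_inputs311Y`'s argument with its four inputs `pos0`, `symm0`, `adj`,
`qps_inj` now THEOREMS at the v4 transporter (`deltaPrimeAY_parSymY_posDefTr`, `symm0_parSymY`, `adj_parSymY`, `qpsY_injective`).
[cite: Balaban1984PropagatorsI, p.25; Balaban1985BackgroundPropagators, (3.25) p.395, Thm 3.11 p.416] -/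
theorem XY_parSymY_posDefTr (hG : G ≤ B7Prop2Explicit.unitaryUnits (Matrix (Fin N) (Fin N) ℂ)) {U : CfgY (Matrix (Fin N) (Fin N) ℂ) i}
    (hU : ∀ μ x, U μ x ∈ G) : PosDefTr (wB i) (XY i (parSymY i) (GpY i (parSymY i)) U) := by
  have hu0 : IsUnit (deltaPrimeAY i (parSymY i) U) := isUnit_deltaPrimeAY_parSymY i hG hU
  have hright : ∀ v, conj311 (eS311 N i) (eS311 N i) (deltaPrimeAY i (parSymY i) U)
      (conj311 (eS311 N i) (eS311 N i) (GpY i (parSymY i) U) v) = v := fun v => conj311_apply_conj311_inverse _ hu0 v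
  have hsymm0 := (symm_conj311_realify311_iff (w := fun _ : SiteY i => (1 : ℝ)) (hw := fun _ => one_pos)
    (deltaPrimeAY i (parSymY i) U)).mpr (symm0_parSymY i hG hU)
  have hg : ∀ u v, inner ℝ (conj311 (eS311 N i) (eS311 N i) (GpY i (parSymY i) U) u) v =
      inner ℝ u (conj311 (eS311 N i) (eS311 N i) (GpY i (parSymY i) U) v) := fun u v => by
    conv_lhs => rw [← hright v]
    conv_rhs => rw [← hright u]
    exact (hsymm0 _ _).symm
  have hginj : Function.Injective (conj311 (eS311 N i) (eS311 N i) (GpY i (parSymY i) U)) := fun u v huv => by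
    rw [← hright u, ← hright v, huv]
  have hadj := (adj_conj311_realify311_iff (w := fun _ : SiteY i => (1 : ℝ)) (hw := fun _ => one_pos)
    (w' := wB i) (hw' := wB_pos i) (QpY i (parSymY i) U) (QpsY i (parSymY i) U)).mpr (adj_parSymY i hG hU)
  have hqs := (injective_conj311_iff (eB311 N i) (eS311 N i) (QpsY i (parSymY i) U)).mpr (qpsY_injective i (parSymY i) U)
  have hpd := posDef_qggqs hadj hg hginj hqs
  have hconj : conj311 (eS311 N i) (eB311 N i) (QpY i (parSymY i) U) ∘ₗ
      conj311 (eS311 N i) (eS311 N i) (GpY i (parSymY i) U) ∘ₗ conj311 (eS311 N i) (eS311 N i) (GpY i (parSymY i) U) ∘ₗ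
        conj311 (eB311 N i) (eS311 N i) (QpsY i (parSymY i) U) =
      conj311 (eB311 N i) (eB311 N i) (XY i (parSymY i) (GpY i (parSymY i)) U) := by
    rw [XY, conj311_comp (eY := eS311 N i), conj311_comp (eY := eS311 N i), conj311_comp (eY := eS311 N i)]
  change B9Thm311Data.PosDef (conj311 (eS311 N i) (eB311 N i) (QpY i (parSymY i) U) ∘ₗ
      conj311 (eS311 N i) (eS311 N i) (GpY i (parSymY i) U) ∘ₗ conj311 (eS311 N i) (eS311 N i) (GpY i (parSymY i) U) ∘ₗ
        conj311 (eB311 N i) (eS311 N i) (QpsY i (parSymY i) U)) at hpd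
  rw [hconj] at hpd
  exact (posDef_conj311_realify311_iff _).mp hpd

/-- hence `(Q′G′²Q′\*)(U)` is a UNIT at every `G`-valued configuration: def-Y's `XinvY = Ring.inverse (Q′G′²Q′\*)(U)` IS the two-sided inverse `C(U)` there
(no Theorem 3.2 needed for the existence; the operator `L` whose inverse kernel Theorem 3.9 expands is invertible at every unitary background).
[cite: Balaban1985BackgroundPropagators, (3.25) p.395, (3.48) p.398] -/
theorem isUnit_XY_parSymY (hG : G ≤ B7Prop2Explicit.unitaryUnits (Matrix (Fin N) (Fin N) ℂ)) {U : CfgY (Matrix (Fin N) (Fin N) ℂ) i}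
    (hU : ∀ μ x, U μ x ∈ G) : IsUnit (XY i (parSymY i) (GpY i (parSymY i)) U) :=
  isUnit_of_posDefTr (XY_parSymY_posDefTr i hG hU)

/-- ★★ **THEOREM 3.11's THIRD OPERATOR `(Q′G′²Q′\*)⁻¹(U)` IS POSITIVE DEFINITE** (block-volume scalar product) at every `G`-valued configuration,
`G ≤ U(N)`. [cite: Balaban1985BackgroundPropagators, p.395 («positivity of … Q′G′²Q′\*»), Thm 3.11 p.416] -/
theorem XinvY_parSymY_posDefTr (hG : G ≤ B7Prop2Explicit.unitaryUnits (Matrix (Fin N) (Fin N) ℂ)) {U : CfgY (Matrix (Fin N) (Fin N) ℂ) i}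
    (hU : ∀ μ x, U μ x ∈ G) : PosDefTr (wB i) (XinvY i (parSymY i) (GpY i (parSymY i)) U) :=
  posDefTr_ringInverse (XY_parSymY_posDefTr i hG hU)

/-- ★★★ **«THIS IS OBVIOUS FOR THE FIRST THREE OPERATORS» — AS A THEOREM AT def-Y's v4 LETTERS**: for every `G`-valued configuration (`G ≤ U(N)`;
`G = SU(N)` covers all of (3.35) and every other unitary background) the genuine `Δ′_a(U)`, `G′(U) = Δ′_a(U)⁻¹` and `(Q′G′²Q′\*)⁻¹(U)` are positive
definite — unconditionally, outside the all-or-nothing package `B9.Thm311Printed` (whose remaining input at the record is the positivity of `Δ_a(U)`).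
[cite: Balaban1985BackgroundPropagators, Thm 3.11 p.416, (3.24)–(3.25) pp.394–395] -/
theorem thm311_firstThree_parSymY (hG : G ≤ B7Prop2Explicit.unitaryUnits (Matrix (Fin N) (Fin N) ℂ)) {U : CfgY (Matrix (Fin N) (Fin N) ℂ) i}
    (hU : ∀ μ x, U μ x ∈ G) :
    PosDefTr (fun _ => (1 : ℝ)) (deltaPrimeAY i (parSymY i) U) ∧ PosDefTr (fun _ => (1 : ℝ)) (GpY i (parSymY i) U) ∧
      PosDefTr (wB i) (XinvY i (parSymY i) (GpY i (parSymY i)) U) :=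
  ⟨deltaPrimeAY_parSymY_posDefTr i hG hU, GpY_parSymY_posDefTr i hG hU, XinvY_parSymY_posDefTr i hG hU⟩

end FirstThree

end

end Literature.MathematicalPhysics.QuantumFieldTheory.Balaban1983to89.B9Thm311PosAtRecordV4
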